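import Summits.QuantumAdvantage.QuantumAdvantage.Theorems.LinnikCubicClassGroupsDegreeOnePrimesEscapeClassPNTNoExceptional
import Literature.NumberTheory.LFunctions.ClassGroupLFunctionExceptionalZeroOfNoSiegel
import HarnessLib

/-!
# The class prime number theorem with no exceptional term in EVERY degree:
# the Siegel–Walfisz range unconditionally, and the Linnik range under `NoSiegelZeros`
# (the effective Stark range is in `…ClassPNTEffective.lean`)

Topic `Summits/QuantumAdvantage/QuantumAdvantage/Theorems`, cell B2b-1 (linnik-cubic), PART A seat 5;
helper for the crux `DegreeOnePrimesEscape` (stmt-QuantumAdvantage-11543) of route `LinnikCubicClassGroups`.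
HONEST FRAMING: the value of this file is a THEOREM (kernel-checked, GRH-free) — NOT summit progress
(the route still rests on the hypothesis-type target `PureCubicClassNumberHard`).

Seat 4 (`…ClassPNTNoExceptional.lean`) removed the exceptional term of the tree's additive class prime
number theorem (`classPNTAdditive_eps_of_kappa_local` + `Residue.residueLowerBound_all`, a dichotomy with
a possible real zero `β₁ ∈ (1 − 1/(8 log Q), 1)` of a real class group character) in ODD degree, where
Stark's theorem forbids `β₁`.  In EVEN degree `β₁` may exist, but by
`exists_dirichletCharacter_realZero_of_classGroupLFunction_eq_zero` (Literature, this seat) it is a zero of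
a quadratic Dirichlet `L`-function of modulus `M ≤ |d_K|`, so it obeys Siegel's bound
(`classGroupLFunction_siegel`: `1 − β₁ ≥ C(n,δ)|d_K|^{−δ}`) unconditionally and the bound
`1 − β₁ ≥ c/((2n)!·log|d_K|)` under the no-Siegel-zero conjecture for quadratic Dirichlet characters
(`classGroupLFunction_ne_zero_of_noSiegelZeros`).  With the absorption lemma
`offsetLogIntegral_rpow_le_mul` (`Li(x^{β₁}) ≤ ε Li(x)` once `(1 − β₁) log x` is large):

* `classPNT_eps_of_zeroRepulsion (n) (ε)` — the common engine: if every such `β₁` of `K` satisfies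
  `β₁ ≤ 1 − 1/log R` for some `R ≥ 12`, then `|π_C(x) − Li(x)/h_K| ≤ ε·Li(x)/h_K` for `x ≥ Q^{c₁}`,
  `x ≥ R^{c₀}` (`c₁, c₀` depending on `n, ε` only);
* `classPNT_eps_siegelWalfisz (n) (ε) (δ)` — **UNCONDITIONAL, every number field `K` of degree `n > 1`,
  every ideal class `C`: `|π_C(x) − Li(x)/h_K| ≤ ε·Li(x)/h_K` for all `x ≥ Q^{c₁}` with
  `x ≥ exp(c₁·|d_K|^{δ})`** (`c₁ = c₁(n, ε, δ)`, ineffective — the Siegel–Walfisz theorem for ideal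
  classes, cf. [Goldstein1970] for ray classes; here kernel-checked from the tree);
* `classPNT_eps_of_noSiegelZeros (h) (n) (ε)` — **under `NoSiegelZeros`**: the same for all `x ≥ Q^{c₁}`
  (Linnik range, no exceptional term, EVERY degree), and `exists_prime_mem_class_absNorm_le_of_noSiegelZeros`
  — every ideal class of every number field of degree `n` contains a prime ideal of norm `≤ Q^{L(n)}`.

## References

* J. Thorner, A. Zaman, *A unified and improved Chebotarev density theorem*, Algebra Number Theory 13
  (2019), Thm. 1.4 (the dichotomy with `β₁`). [ThornerZaman2019]
* L. J. Goldstein, *A generalization of the Siegel–Walfisz theorem*, Trans. Amer. Math. Soc. 149 (1970)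
  417–429 (PNT for ray classes uniform in `N𝔣·|d_K| ≤ (log x)^A`). [Goldstein1970]
* H. L. Montgomery, R. C. Vaughan, *Multiplicative Number Theory I*, CUP 2007, Cor. 11.15, §11.3.
  [MontgomeryVaughan2007]
* A. Weiss, *The least prime ideal*, J. reine angew. Math. 338 (1983) 56–94. [Weiss1983]
-/

noncomputable section

open Complex Real MeasureTheory Set Filter Topology
open scoped NumberField nonZeroDivisors

namespace Summit.QuantumAdvantage.QuantumAdvantage.Theorems.DegreeOnePrimesEscape

open Literature.NumberTheory.LFunctions Literature.NumberTheory.LFunctions.NumberField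
  Literature.NumberTheory.LFunctions.AbelianDensity

/-! ### The engine: a repulsion bound for the exceptional zero removes the exceptional term -/

/-- **Class PNT with no exceptional term from a repulsion bound for the exceptional zero.**  For `n > 1`
and `ε > 0` there are `c₁, c₀ > 0` such that for every number field `K` of degree `n` and every `R ≥ 12`
with the property that every real zero `β ∈ (1 − 1/(8 log Q), 1)` of every real class group character of
`K` satisfies `β ≤ 1 − 1/log R`: for every class `C` and every `x` with `x ≥ Q^{c₁}` and `x ≥ R^{c₀}`,
`|π_C(x) − Li(x)/h_K| ≤ ε·Li(x)/h_K` (`Q = condQn K = |d_K|·nⁿ`).  (The dichotomy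
`classPNTAdditive_eps_of_kappa_local`, residue by `Residue.residueLowerBound_all`, absorption by
`offsetLogIntegral_rpow_le_mul` with `Q := R`, `c := 1`.) -/
theorem classPNT_eps_of_zeroRepulsion (n : ℕ) (hn : 1 < n) {ε : ℝ} (hε : 0 < ε) :
    ∃ c₁ c₀ : ℝ, 0 < c₁ ∧ 0 < c₀ ∧ ∀ (K : Type) [Field K] [NumberField K], Module.finrank ℚ K = n →
      ∀ R : ℝ, 12 ≤ R →
        (∀ χ : ClassGroup (𝓞 K) →* ℂˣ, χ * χ = 1 → ∀ β : ℝ,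
            1 - 1 / (8 * Real.log (ThornerZaman.condQn K)) < β → β < 1 →
              classGroupLFunction K χ β = 0 → β ≤ 1 - 1 / Real.log R) →
        ∀ (C : ClassGroup (𝓞 K)) (x : ℝ), ThornerZaman.condQn K ^ c₁ ≤ x → R ^ c₀ ≤ x →
          |(primeIdealClassCount K C x : ℝ) - offsetLogIntegral x / NumberField.classNumber K| ≤
            ε * offsetLogIntegral x / NumberField.classNumber K := by
  classical
  obtain ⟨A, -, hA⟩ := Residue.residueLowerBound_all n
  obtain ⟨c₁, hc₁, h⟩ := classPNTAdditive_eps_of_kappa_local n hn A (half_pos hε)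
  obtain ⟨c₀, hc₀, habs⟩ := offsetLogIntegral_rpow_le_mul one_pos (half_pos hε)
  refine ⟨max c₁ 1, c₀, lt_max_of_lt_right one_pos, hc₀, fun K _ _ hKn R hR hrep C x hx hxR => ?_⟩
  have hK : 1 < Module.finrank ℚ K := by rw [hKn]; exact hn
  set Q : ℝ := ThornerZaman.condQn K with hQ
  have hQ12 : (12 : ℝ) ≤ Q := ThornerZaman.twelve_le_condQn (K := K) hK
  have hQ1 : (1 : ℝ) < Q := by linarith
  have hlogQ : 2 ≤ Real.log Q := two_lt_log_twelve.le.trans (Real.log_le_log (by norm_num) hQ12)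
  have hx₁ : Q ^ c₁ ≤ x := (Real.rpow_le_rpow_of_exponent_le hQ1.le (le_max_left _ _)).trans hx
  have hxQ : Q ≤ x := by
    have := (Real.rpow_le_rpow_of_exponent_le hQ1.le (le_max_right c₁ 1)).trans hx
    rwa [Real.rpow_one] at this
  set hcl : ℝ := (NumberField.classNumber K : ℝ) with hh
  have hh0 : 0 < hcl := by
    rw [hh]; exact_mod_cast Nat.lt_of_lt_of_le Nat.zero_lt_one (one_le_classNumber (K := K))
  rcases h K hKn (hA K hKn) with h1 | ⟨χ₁, β₁, hreal, hβQ, hβ1, hz, hbd⟩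
  · have := h1 C x hx₁
    calc _ ≤ ε / 2 * offsetLogIntegral x / hcl := this
      _ ≤ ε * offsetLogIntegral x / hcl := by
          have hLi : 0 ≤ offsetLogIntegral x := by
            have h0 := offsetLogIntegralPow_nonneg 1 (show (2:ℝ) ≤ x by linarith)
            rwa [offsetLogIntegralPow_one] at h0
          gcongr; linarith
  · -- the zero is repelled: `β₁ ≤ 1 − 1/log R`
    have hβR : β₁ ≤ 1 - 1 / Real.log R := hrep χ₁ hreal β₁ hβQ hβ1 hz
    have hβhalf : 1 / 2 ≤ β₁ := by
      have : 1 / (8 * Real.log Q) ≤ 1 / 16 := by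
        rw [div_le_div_iff₀ (by positivity) (by norm_num)]; nlinarith
      linarith
    obtain ⟨hLi0, hLiβ⟩ := habs R hR β₁ hβhalf hβR x hxR
    have hmain := hbd C x hx₁
    -- `|Re χ₁(C)| ≤ 1`
    have hre : |((χ₁ C : ℂ)).re| ≤ 1 := by
      rcases re_classGroupChar_apply hreal C with h1 | h1 <;> rw [h1] <;> norm_num
    -- triangle inequality
    have hdiff : |(offsetLogIntegral x - ((χ₁ C : ℂ)).re * offsetLogIntegral (x ^ β₁)) / hcl -
        offsetLogIntegral x / hcl| ≤ ε / 2 * offsetLogIntegral x / hcl := by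
      rw [show (offsetLogIntegral x - ((χ₁ C : ℂ)).re * offsetLogIntegral (x ^ β₁)) / hcl -
          offsetLogIntegral x / hcl = -(((χ₁ C : ℂ)).re * offsetLogIntegral (x ^ β₁) / hcl) by ring,
        abs_neg, abs_div, abs_mul, abs_of_pos hh0, abs_of_nonneg hLi0]
      rw [div_le_div_iff_of_pos_right hh0]
      calc |((χ₁ C : ℂ)).re| * offsetLogIntegral (x ^ β₁) ≤ 1 * offsetLogIntegral (x ^ β₁) :=
            mul_le_mul_of_nonneg_right hre hLi0
        _ ≤ ε / 2 * offsetLogIntegral x := by rw [one_mul]; exact hLiβ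
    calc |(primeIdealClassCount K C x : ℝ) - offsetLogIntegral x / hcl|
        ≤ |(primeIdealClassCount K C x : ℝ) -
            (offsetLogIntegral x - ((χ₁ C : ℂ)).re * offsetLogIntegral (x ^ β₁)) / hcl| +
          |(offsetLogIntegral x - ((χ₁ C : ℂ)).re * offsetLogIntegral (x ^ β₁)) / hcl -
            offsetLogIntegral x / hcl| := abs_sub_le _ _ _
      _ ≤ ε / 2 * offsetLogIntegral x / hcl + ε / 2 * offsetLogIntegral x / hcl := add_le_add hmain hdiff
      _ = ε * offsetLogIntegral x / hcl := by ring

/-! ### Unconditional: the Siegel–Walfisz range, every degree -/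

/-- **Siegel–Walfisz theorem for ideal classes, every number field of degree `n`** (unconditional,
ineffective): for `n > 1`, `ε > 0`, `δ > 0` there is `c₁ > 0` such that for every number field `K` of
degree `n`, every ideal class `C` and every `x` with `x ≥ Q^{c₁}` and `x ≥ exp(c₁·|d_K|^{δ})`:
`|π_C(x) − Li(x)/h_K| ≤ ε·Li(x)/h_K`.  (Engine + Siegel's bound for class group `L`-functions,
`classGroupLFunction_siegel`: the possible exceptional zero satisfies `1 − β₁ ≥ C|d_K|^{−δ}`; take
`R = exp(max(|d_K|^δ/C, 3))`.)  [cite: Goldstein1970, Main Theorem p. 418 (normal K, Grössencharacters; cf.)]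
[cite: MontgomeryVaughan2007, Corollary 11.15] -/
theorem classPNT_eps_siegelWalfisz (n : ℕ) (hn : 1 < n) {ε δ : ℝ} (hε : 0 < ε) (hδ : 0 < δ) :
    ∃ c₁ : ℝ, 0 < c₁ ∧ ∀ (K : Type) [Field K] [NumberField K], Module.finrank ℚ K = n →
      ∀ (C : ClassGroup (𝓞 K)) (x : ℝ), ThornerZaman.condQn K ^ c₁ ≤ x →
        Real.exp (c₁ * ((NumberField.discr K).natAbs : ℝ) ^ δ) ≤ x →
          |(primeIdealClassCount K C x : ℝ) - offsetLogIntegral x / NumberField.classNumber K| ≤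
            ε * offsetLogIntegral x / NumberField.classNumber K := by
  classical
  obtain ⟨c₁, c₀, hc₁, hc₀, h⟩ := classPNT_eps_of_zeroRepulsion n hn hε
  obtain ⟨C, hC, hS⟩ := classGroupLFunction_siegel n hn hδ
  refine ⟨max (max c₁ (2 * c₀)) (c₀ / C), lt_max_of_lt_left (lt_max_of_lt_left hc₁),
    fun K _ _ hKn Cl x hx hxe => ?_⟩
  have hK : 1 < Module.finrank ℚ K := by rw [hKn]; exact hn
  set Q : ℝ := ThornerZaman.condQn K with hQ
  have hQ12 : (12 : ℝ) ≤ Q := ThornerZaman.twelve_le_condQn (K := K) hK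
  have hQ1 : (1 : ℝ) < Q := by linarith
  have hlogQ : 2 ≤ Real.log Q := two_lt_log_twelve.le.trans (Real.log_le_log (by norm_num) hQ12)
  set d : ℝ := ((NumberField.discr K).natAbs : ℝ) with hd
  have hd1 : (1 : ℝ) ≤ d := by
    have h1 := Int.one_le_abs (NumberField.discr_ne_zero K)
    rw [Int.abs_eq_natAbs] at h1
    rw [hd]; exact_mod_cast h1
  have hdδ : 0 < d ^ δ := Real.rpow_pos_of_pos (by linarith) δ
  -- the repulsion parameter `R = exp(max(d^δ/C, 3)) ≥ e³ > 12`
  set R : ℝ := Real.exp (max (d ^ δ / C) 3) with hR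
  have hlogR : Real.log R = max (d ^ δ / C) 3 := by rw [hR, Real.log_exp]
  have hR12 : (12 : ℝ) ≤ R := by
    have h3 : Real.exp 3 ≤ R := Real.exp_le_exp.mpr (le_max_right _ _)
    have he : (12 : ℝ) ≤ Real.exp 3 := by
      have h9 : Real.exp 3 = Real.exp 1 ^ 3 := by
        rw [← Real.exp_nat_mul]; norm_num
      have h1 : (2.7182818283 : ℝ) ≤ Real.exp 1 := Real.exp_one_gt_d9.le
      have h27 : (2.7182818283 : ℝ) ^ 3 ≤ Real.exp 1 ^ 3 := pow_le_pow_left₀ (by norm_num) h1 3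
      rw [h9]
      exact le_trans (by norm_num) h27
    linarith
  have hrep : ∀ χ : ClassGroup (𝓞 K) →* ℂˣ, χ * χ = 1 → ∀ β : ℝ,
      1 - 1 / (8 * Real.log (ThornerZaman.condQn K)) < β → β < 1 →
        classGroupLFunction K χ β = 0 → β ≤ 1 - 1 / Real.log R := by
    intro χ hχ β _ hβ1 hz
    have hSβ : C * d ^ (-δ) ≤ 1 - β := hS K hKn χ hχ β hβ1 hz
    have h1 : 1 / Real.log R ≤ C * d ^ (-δ) := by
      rw [hlogR, Real.rpow_neg (by linarith)]
      have hle : d ^ δ / C ≤ max (d ^ δ / C) 3 := le_max_left _ _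
      have hpos : 0 < d ^ δ / C := by positivity
      calc 1 / max (d ^ δ / C) 3 ≤ 1 / (d ^ δ / C) := one_div_le_one_div_of_le hpos hle
        _ = C * (d ^ δ)⁻¹ := by field_simp
    linarith
  refine h K hKn R hR12 hrep Cl x ?_ ?_
  · exact (Real.rpow_le_rpow_of_exponent_le hQ1.le ((le_max_left _ _).trans (le_max_left _ _))).trans hx
  · -- `R^{c₀} = exp(c₀ · max(d^δ/C, 3)) ≤ x`
    rw [hR, ← Real.exp_mul]
    rcases le_total (d ^ δ / C) 3 with hle | hle
    · rw [max_eq_right hle]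
      -- `exp(3 c₀) ≤ Q^{2 c₀} ≤ Q^{c₁'} ≤ x`
      have h2 : Q ^ (2 * c₀) ≤ x :=
        (Real.rpow_le_rpow_of_exponent_le hQ1.le ((le_max_right _ _).trans (le_max_left _ _))).trans hx
      have h3 : Real.exp (3 * c₀) ≤ Q ^ (2 * c₀) := by
        rw [Real.rpow_def_of_pos (by linarith), Real.exp_le_exp]
        nlinarith
      linarith
    · rw [max_eq_left hle]
      have h2 : Real.exp (d ^ δ / C * c₀) ≤ Real.exp (max (max c₁ (2 * c₀)) (c₀ / C) * d ^ δ) := by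
        rw [Real.exp_le_exp]
        have : d ^ δ / C * c₀ = c₀ / C * d ^ δ := by ring
        rw [this]
        exact mul_le_mul_of_nonneg_right (le_max_right _ _) hdδ.le
      exact h2.trans hxe

/-! ### Under `NoSiegelZeros`: the Linnik range, every degree -/

/-- **Under the no-Siegel-zero conjecture for quadratic Dirichlet characters: class PNT with NO
exceptional term for every number field of degree `n > 1`, in the Linnik range.**  Assume `NoSiegelZeros`
(tree, rh.S34, by name). For `n > 1` and `ε > 0` there is `c₁ > 0` such that for every number field `K`
of degree `n`, every class `C` and every `x ≥ Q^{c₁}`: `|π_C(x) − Li(x)/h_K| ≤ ε·Li(x)/h_K`.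
(Engine + `classGroupLFunction_ne_zero_of_noSiegelZeros` with `R = Q^{max((2n)!/c, 1)}`.)
CONDITIONAL on an open conjecture (hypothesis `hNS`). [cite: ThornerZaman2019, Thm. 1.4] -/
theorem classPNT_eps_of_noSiegelZeros (hNS : NoSiegelZeros) (n : ℕ) (hn : 1 < n) {ε : ℝ} (hε : 0 < ε) :
    ∃ c₁ : ℝ, 0 < c₁ ∧ ∀ (K : Type) [Field K] [NumberField K], Module.finrank ℚ K = n →
      ∀ (C : ClassGroup (𝓞 K)) (x : ℝ), ThornerZaman.condQn K ^ c₁ ≤ x →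
        |(primeIdealClassCount K C x : ℝ) - offsetLogIntegral x / NumberField.classNumber K| ≤
          ε * offsetLogIntegral x / NumberField.classNumber K := by
  classical
  obtain ⟨c₁, c₀, hc₁, hc₀, h⟩ := classPNT_eps_of_zeroRepulsion n hn hε
  obtain ⟨c, hc, hNZ⟩ := classGroupLFunction_ne_zero_of_noSiegelZeros hNS
  set e : ℝ := max (((2 * n).factorial : ℝ) / c) 1 with he
  have he1 : 1 ≤ e := le_max_right _ _
  have he0 : 0 < e := by linarith
  refine ⟨max c₁ (c₀ * e), lt_max_of_lt_left hc₁, fun K _ _ hKn Cl x hx => ?_⟩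
  have hK : 1 < Module.finrank ℚ K := by rw [hKn]; exact hn
  set Q : ℝ := ThornerZaman.condQn K with hQ
  have hQ12 : (12 : ℝ) ≤ Q := ThornerZaman.twelve_le_condQn (K := K) hK
  have hQ1 : (1 : ℝ) < Q := by linarith
  have hlogQ : 2 ≤ Real.log Q := two_lt_log_twelve.le.trans (Real.log_le_log (by norm_num) hQ12)
  have hfac0 : (0 : ℝ) < ((2 * n).factorial : ℝ) := by exact_mod_cast Nat.factorial_pos _
  -- `|d_K| ≥ 3`, `0 < log|d_K| ≤ log Q`
  have hd3 : (3 : ℝ) ≤ ((NumberField.discr K).natAbs : ℝ) := by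
    have h2 := NumberField.abs_discr_gt_two hK
    rw [Nat.cast_natAbs]
    exact_mod_cast (show (3 : ℤ) ≤ |NumberField.discr K| by omega)
  have hlogd : 0 < Real.log ((NumberField.discr K).natAbs : ℝ) := Real.log_pos (by linarith)
  have hdQ : Real.log ((NumberField.discr K).natAbs : ℝ) ≤ Real.log Q := by
    refine Real.log_le_log (by linarith) ?_
    rw [Nat.cast_natAbs, Int.cast_abs]
    exact ThornerZaman.abs_discr_le_condQn K
  -- the repulsion parameter `R = Q^e ≥ Q ≥ 12`, `log R = e log Q ≥ ((2n)!/c) log Q`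
  set R : ℝ := Q ^ e with hR
  have hR12 : (12 : ℝ) ≤ R := by
    have := Real.rpow_le_rpow_of_exponent_le hQ1.le he1
    rw [Real.rpow_one] at this
    exact hQ12.trans this
  have hlogR : Real.log R = e * Real.log Q := by rw [hR, Real.log_rpow (by linarith)]
  have hrep : ∀ χ : ClassGroup (𝓞 K) →* ℂˣ, χ * χ = 1 → ∀ β : ℝ,
      1 - 1 / (8 * Real.log (ThornerZaman.condQn K)) < β → β < 1 →
        classGroupLFunction K χ β = 0 → β ≤ 1 - 1 / Real.log R := by
    intro χ hχ β _ hβ1 hz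
    by_contra hlt
    push Not at hlt
    -- `1 − c/((2n)! log d) ≤ 1 − 1/log R < β`
    have h1 : 1 / Real.log R ≤ c / (((2 * Module.finrank ℚ K).factorial : ℝ) *
        Real.log ((NumberField.discr K).natAbs : ℝ)) := by
      rw [hKn, hlogR, div_le_div_iff₀ (by positivity) (by positivity), one_mul]
      have h2 : ((2 * n).factorial : ℝ) ≤ e * c := by
        have := le_max_left (((2 * n).factorial : ℝ) / c) 1
        rw [← he] at this
        have := mul_le_mul_of_nonneg_right this hc.le
        rwa [div_mul_cancel₀ _ hc.ne'] at this
      calc ((2 * n).factorial : ℝ) * Real.log ((NumberField.discr K).natAbs : ℝ)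
          ≤ (e * c) * Real.log Q := mul_le_mul h2 hdQ hlogd.le (by positivity)
        _ = c * (e * Real.log Q) := by ring
    have hσ : 1 - c / (((2 * Module.finrank ℚ K).factorial : ℝ) *
        Real.log ((NumberField.discr K).natAbs : ℝ)) < β := by linarith
    exact hNZ K hK χ hχ β hσ hβ1 hz
  refine h K hKn R hR12 hrep Cl x ?_ ?_
  · exact (Real.rpow_le_rpow_of_exponent_le hQ1.le (le_max_left _ _)).trans hx
  · -- `R^{c₀} = Q^{e c₀} ≤ Q^{c₁'} ≤ x`
    rw [hR, ← Real.rpow_mul (by linarith)]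
    have : e * c₀ = c₀ * e := mul_comm _ _
    rw [this]
    exact (Real.rpow_le_rpow_of_exponent_le hQ1.le (le_max_right _ _)).trans hx

/-- **Least prime ideal in an ideal class, every degree, under `NoSiegelZeros`**: assuming the
no-Siegel-zero conjecture for quadratic Dirichlet characters, for `n > 1` there is `L > 0` such that every
ideal class of every number field `K` of degree `n` contains a prime ideal of norm `≤ Q^{L}`,
`Q = |d_K|·nⁿ`.  (Unconditional in odd degree: `exists_prime_mem_class_absNorm_le_of_odd`; known
unconditionally in every degree via Deuring–Heilbronn [Weiss1983], not in the tree.)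
CONDITIONAL on an open conjecture (hypothesis `hNS`). [cite: Weiss1983, Theorem 5.2 (unconditional, DH)] -/
theorem exists_prime_mem_class_absNorm_le_of_noSiegelZeros (hNS : NoSiegelZeros) (n : ℕ) (hn : 1 < n) :
    ∃ L : ℝ, 0 < L ∧ ∀ (K : Type) [Field K] [NumberField K], Module.finrank ℚ K = n →
      ∀ C : ClassGroup (𝓞 K), ∃ (P : Ideal (𝓞 K)) (hP : P ∈ (Ideal (𝓞 K))⁰), P.IsPrime ∧
        ClassGroup.mk0 ⟨P, hP⟩ = C ∧ (Ideal.absNorm P : ℝ) ≤ ThornerZaman.condQn K ^ L := by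
  classical
  obtain ⟨c₁, hc₁, h⟩ := classPNT_eps_of_noSiegelZeros hNS n hn (by norm_num : (0:ℝ) < 1 / 2)
  refine ⟨max c₁ 1, lt_max_of_lt_left hc₁, fun K _ _ hKn C => ?_⟩
  have hK : 1 < Module.finrank ℚ K := by rw [hKn]; exact hn
  set Q : ℝ := ThornerZaman.condQn K with hQ
  have hQ12 : (12 : ℝ) ≤ Q := ThornerZaman.twelve_le_condQn (K := K) hK
  have hQ1 : (1 : ℝ) < Q := by linarith
  set x : ℝ := Q ^ (max c₁ 1) with hx
  have hx₁ : Q ^ c₁ ≤ x := Real.rpow_le_rpow_of_exponent_le hQ1.le (le_max_left _ _)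
  have hxQ : Q ≤ x := by
    have := Real.rpow_le_rpow_of_exponent_le hQ1.le (le_max_right c₁ 1)
    rwa [Real.rpow_one] at this
  have hx2 : (2 : ℝ) < x := by linarith
  have hlogx : 0 < Real.log x := Real.log_pos (by linarith)
  have hLi : 0 < offsetLogIntegral x := by
    have h1 := sub_mul_inv_log_pow_le_offsetLogIntegralPow 1 hx2.le
    rw [pow_one, offsetLogIntegralPow_one] at h1
    exact lt_of_lt_of_le (mul_pos (by linarith) (inv_pos.mpr hlogx)) h1
  set hK' : ℝ := (NumberField.classNumber K : ℝ) with hh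
  have hh0 : 0 < hK' := by
    rw [hh]; exact_mod_cast Nat.lt_of_lt_of_le Nat.zero_lt_one (one_le_classNumber (K := K))
  have hbound := h K hKn C x hx₁
  have hpos : 0 < (primeIdealClassCount K C x : ℝ) := by
    have h1 := (abs_sub_le_iff.mp hbound).2
    have h2 : 0 < offsetLogIntegral x / hK' - 1 / 2 * offsetLogIntegral x / hK' := by
      rw [← sub_div, show offsetLogIntegral x - 1 / 2 * offsetLogIntegral x = offsetLogIntegral x / 2 by ring]
      positivity
    linarith
  have hne : primeIdealClassCount K C x ≠ 0 := by
    intro h0; rw [h0, Nat.cast_zero] at hpos; exact lt_irrefl _ hpos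
  obtain ⟨P, hPprime, hPx, hP0, hPC⟩ := Set.nonempty_of_ncard_ne_zero hne
  exact ⟨P, hP0, hPprime, hPC, hPx⟩

end Summit.QuantumAdvantage.QuantumAdvantage.Theorems.DegreeOnePrimesEscape

end
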